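import Mathlib.Analysis.Complex.Harmonic.Analytic
import Mathlib.Analysis.Calculus.MeanValue
import Mathlib.Analysis.Calculus.Deriv.Pow
import Mathlib.Analysis.Calculus.Deriv.Inv
import HarnessLib

/-!
# Homogeneous harmonic functions on a plane sector are harmonic polynomials

A real function `f` which is harmonic on an open connected cone `S ⊆ ℂ ∖ {0}` (a «sector», stable under the positive dilations
`z ↦ r·z`, `r > 0`) and positively homogeneous of INTEGER degree `k ≥ 1` there (`f (r·z) = rᵏ·f z`) is the restriction of a harmonic
polynomial: `f z = Re (c·zᵏ)` for one `c ∈ ℂ`.  In polar form this is the ODE fact «`g″ + k²g = 0` ⇒ `g = A cos kφ + B sin kφ`»; we prove it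
through the holomorphic function `g = ∂f∕∂x − i·∂f∕∂y` (Mathlib `HarmonicAt.differentiableAt_complex_partial`): homogeneity of `f` makes `g`
homogeneous of degree `k − 1`, Euler's relation `z·g′ = (k−1)·g` makes `g∕z^{k−1}` locally constant, so `g = c·z^{k−1}`, and `f − Re((c∕k)·zᵏ)` has
vanishing gradient.  The degree-`0` analogue is FALSE (`arg z` is harmonic and homogeneous of degree `0` on any sector) — hence `1 ≤ k`.
Corollary for complex-valued `f`: `f z = a·zᵏ + b·z̄ᵏ`.

These statements are the 2-dimensional mechanism behind «homogeneous expansions of Weyl-chamber functions satisfying a Casimir (Laplace)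
equation are polynomial term by term» (cell `pub/hodgecm-mathlib`, ENGINE T1, ROAD A, census `CENSUS-N1-WhatSdConsumes.F0P3a-p02g13` §3);
the file itself is Mathlib-only planar harmonic analysis.

## References
* [AxlerBourdonRamey2001] S. Axler, P. Bourdon, W. Ramey, *Harmonic Function Theory*, 2nd ed., GTM 137 (2001), Ch. 1 (harmonic vs. holomorphic in the
  plane; homogeneous harmonic functions), Ch. 5 (harmonic polynomials).
-/

set_option autoImplicit false

noncomputable section

open Complex InnerProductSpace Set Filter Topology

namespace Literature.Analysis.Potential

/-! ## §1 Calculus of positively homogeneous functions on a cone in `ℂ` -/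

section Homogeneous

variable {S : Set ℂ} {f : ℂ → ℝ} {k : ℕ}

/-- **The gradient of a homogeneous function is homogeneous of one degree less**: if `f (r·w) = rᵏ·f w` for `w ∈ S` (open), `r > 0`, `r·S ⊆ S`,
and `f` is differentiable on `S`, then `Df(r·z)[v] = r^{k−1}·Df(z)[v]` for `z ∈ S`, `1 ≤ k`. [folklore] [cite: AxlerBourdonRamey2001, Ch. 1] -/
theorem fderiv_apply_mul_of_homogeneous (hS : IsOpen S) (hdil : ∀ z ∈ S, ∀ r : ℝ, 0 < r → (r : ℂ) * z ∈ S)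
    (hf : DifferentiableOn ℝ f S) (hk : 1 ≤ k) (hhom : ∀ z ∈ S, ∀ r : ℝ, 0 < r → f ((r : ℂ) * z) = r ^ k * f z)
    {z : ℂ} (hz : z ∈ S) {r : ℝ} (hr : 0 < r) (v : ℂ) :
    fderiv ℝ f ((r : ℂ) * z) v = r ^ (k - 1) * fderiv ℝ f z v := by
  -- `w ↦ f (r·w)` and `w ↦ rᵏ·f w` agree near `z`
  have hev : (fun w : ℂ => f ((r : ℂ) * w)) =ᶠ[𝓝 z] fun w : ℂ => r ^ k * f w := by
    filter_upwards [hS.mem_nhds hz] with w hw using hhom w hw r hr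
  have hrz : (r : ℂ) * z ∈ S := hdil z hz r hr
  have hfd : DifferentiableAt ℝ f ((r : ℂ) * z) := hf.differentiableAt (hS.mem_nhds hrz)
  have hfdz : DifferentiableAt ℝ f z := hf.differentiableAt (hS.mem_nhds hz)
  -- chain rule for the left-hand side
  have hmul := ((hasFDerivAt_id (𝕜 := ℝ) z).const_mul (r : ℂ))
  have hL : HasFDerivAt (fun w : ℂ => f ((r : ℂ) * w)) ((fderiv ℝ f ((r : ℂ) * z)).comp ((r : ℂ) • ContinuousLinearMap.id ℝ ℂ)) z := by
    have h := hfd.hasFDerivAt.comp z hmul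
    simpa only [Function.comp_def, id_eq] using h
  have hR : HasFDerivAt (fun w : ℂ => r ^ k * f w) ((r ^ k) • fderiv ℝ f z) z := hfdz.hasFDerivAt.const_mul (r ^ k)
  have heq := hL.unique (hR.congr_of_eventuallyEq hev)
  have happ := congrArg (fun L : ℂ →L[ℝ] ℝ => L v) heq
  simp only [ContinuousLinearMap.comp_apply, smul_apply, ContinuousLinearMap.id_apply, smul_eq_mul] at happ
  -- `Df(rz)[r·v] = r·Df(rz)[v]`
  have hlin : fderiv ℝ f ((r : ℂ) * z) ((r : ℂ) * v) = r * fderiv ℝ f ((r : ℂ) * z) v := by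
    rw [show ((r : ℂ) * v) = (r : ℝ) • v from Complex.real_smul.symm, ContinuousLinearMap.map_smul, smul_eq_mul]
  rw [hlin] at happ
  -- divide by `r`
  have hrk : (r : ℝ) ^ k = r * r ^ (k - 1) := by
    rw [← pow_succ']
    congr 1
    omega
  rw [hrk, mul_assoc] at happ
  exact mul_left_cancel₀ hr.ne' happ

end Homogeneous

/-! ## §2 Homogeneous holomorphic functions on a cone: Euler's relation and `g = c·z^m` -/

section Holomorphic

variable {S : Set ℂ} {g : ℂ → ℂ} {m : ℕ}

/-- **Euler's relation for a homogeneous holomorphic function**: `g` complex-differentiable at `z ∈ S` and `g (r·z) = r^m·g z` for `r > 0`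
(`S` open) ⇒ `z·g′(z) = m·g(z)`. [folklore] [cite: AxlerBourdonRamey2001, Ch. 1] -/
theorem deriv_mul_self_eq_of_homogeneous (hS : IsOpen S) (hg : DifferentiableOn ℂ g S)
    (hhom : ∀ z ∈ S, ∀ r : ℝ, 0 < r → g ((r : ℂ) * z) = (r : ℂ) ^ m * g z) {z : ℂ} (hz : z ∈ S) :
    deriv g z * z = m * g z := by
  have hgd : DifferentiableAt ℂ g z := hg.differentiableAt (hS.mem_nhds hz)
  -- derivative of `r ↦ g (r·z)` at `r = 1` along the reals, by the chain rule
  have h1 : HasDerivAt (fun w : ℂ => g (w * z)) (deriv g z * z) (1 : ℂ) := by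
    have hmul : HasDerivAt (fun w : ℂ => w * z) z (1 : ℂ) := by simpa using (hasDerivAt_id (1 : ℂ)).mul_const z
    have hg1 : HasDerivAt g (deriv g z) ((1 : ℂ) * z) := by simpa using hgd.hasDerivAt
    have hcomp := hg1.comp (1 : ℂ) hmul
    simpa [Function.comp_def] using hcomp
  have h1r : HasDerivAt (fun r : ℝ => g ((r : ℂ) * z)) (deriv g z * z) (1 : ℝ) := by
    simpa using h1.comp_ofReal
  -- derivative of `r ↦ r^m·g z` at `r = 1`
  have h2r : HasDerivAt (fun r : ℝ => ((r : ℂ) ^ m) * g z) ((m : ℂ) * g z) (1 : ℝ) := by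
    have hp : HasDerivAt (fun w : ℂ => w ^ m * g z) ((m : ℂ) * (1 : ℂ) ^ (m - 1) * g z) (1 : ℂ) :=
      (hasDerivAt_pow m (1 : ℂ)).mul_const (g z)
    simpa using hp.comp_ofReal
  -- the two functions agree near `r = 1`
  have hev : (fun r : ℝ => g ((r : ℂ) * z)) =ᶠ[𝓝 (1 : ℝ)] fun r : ℝ => ((r : ℂ) ^ m) * g z := by
    filter_upwards [Ioi_mem_nhds (zero_lt_one' ℝ)] with r hr using hhom z hz r hr
  exact h1r.unique (h2r.congr_of_eventuallyEq hev)

/-- **A homogeneous holomorphic function on a connected cone is a monomial**: `S` open, preconnected, `0 ∉ S`; `g` holomorphic on `S`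
with `g (r·z) = r^m·g z` (`r > 0`, `z ∈ S`) ⇒ `∃ c, ∀ z ∈ S, g z = c·z^m` (`g∕z^m` has zero derivative by Euler's relation). [folklore] [cite: AxlerBourdonRamey2001, Ch. 1] -/
theorem exists_eq_const_mul_pow_of_homogeneous (hS : IsOpen S) (hSc : IsPreconnected S) (h0 : (0 : ℂ) ∉ S)
    (hg : DifferentiableOn ℂ g S) (hhom : ∀ z ∈ S, ∀ r : ℝ, 0 < r → g ((r : ℂ) * z) = (r : ℂ) ^ m * g z) :
    ∃ c : ℂ, ∀ z ∈ S, g z = c * z ^ m := by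
  have hne : ∀ z ∈ S, z ≠ 0 := fun z hz h => h0 (h ▸ hz)
  -- `q := g ∕ z^m` has zero derivative on `S`
  have hq : ∀ z ∈ S, HasDerivAt (fun w : ℂ => g w / w ^ m) 0 z := by
    intro z hz
    have hzm : z ^ m ≠ 0 := pow_ne_zero _ (hne z hz)
    have hgd : HasDerivAt g (deriv g z) z := (hg.differentiableAt (hS.mem_nhds hz)).hasDerivAt
    have hpow : HasDerivAt (fun w : ℂ => w ^ m) ((m : ℂ) * z ^ (m - 1)) z := hasDerivAt_pow m z
    have hdiv := hgd.fun_div hpow hzm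
    have heuler := deriv_mul_self_eq_of_homogeneous hS hg hhom hz
    -- the numerator `g′·z^m − g·m·z^{m−1}` vanishes by Euler's relation
    have hnum : deriv g z * z ^ m - g z * ((m : ℂ) * z ^ (m - 1)) = 0 := by
      rcases Nat.eq_zero_or_pos m with hm | hm
      · subst hm
        have h0' : deriv g z = 0 := by
          have h : deriv g z * z = 0 := by simpa using heuler
          exact (mul_eq_zero.mp h).resolve_right (hne z hz)
        simp [h0']
      · have hsplit : z ^ m = z * z ^ (m - 1) := by
          rw [← pow_succ']; congr 1; omega
        rw [hsplit, ← mul_assoc, heuler]; ring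
    refine hdiv.congr_deriv ?_
    rw [hnum, zero_div]
  have hqd : DifferentiableOn ℂ (fun w : ℂ => g w / w ^ m) S := fun z hz => (hq z hz).differentiableAt.differentiableWithinAt
  obtain ⟨c, hc⟩ := hS.exists_is_const_of_deriv_eq_zero hSc hqd (fun z hz => by simpa using (hq z hz).deriv)
  refine ⟨c, fun z hz => ?_⟩
  have hzm : z ^ m ≠ 0 := pow_ne_zero _ (hne z hz)
  have h := hc z hz
  rw [div_eq_iff hzm] at h
  exact h

end Holomorphic

/-! ## §3 Real parts of holomorphic functions: `∂ₓ Re H − i·∂_y Re H = H′` -/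

section RealPart

/-- For `H` complex-differentiable at `z`: `D(Re H)(z)[v] = Re (v·H′(z))`. [folklore] [cite: AxlerBourdonRamey2001, Ch. 1] -/
theorem fderiv_re_comp_apply {H : ℂ → ℂ} {H' z : ℂ} (hH : HasDerivAt H H' z) (v : ℂ) :
    fderiv ℝ (fun w => (H w).re) z v = (v * H').re := by
  have h1 : HasFDerivAt H (ContinuousLinearMap.smulRight (1 : ℂ →L[ℂ] ℂ) H') z := hH.hasFDerivAt
  have h2 : HasFDerivAt (fun w => (H w).re) (reCLM.comp ((ContinuousLinearMap.smulRight (1 : ℂ →L[ℂ] ℂ) H').restrictScalars ℝ)) z :=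
    reCLM.hasFDerivAt.comp z (h1.restrictScalars ℝ)
  rw [h2.fderiv]
  simp [smul_eq_mul]

/-- **`∂ₓ(Re H) − i·∂_y(Re H) = H′`** for `H` complex-differentiable at `z` (the Cauchy–Riemann bookkeeping behind Mathlib's
`HarmonicAt.differentiableAt_complex_partial`). [folklore] [cite: AxlerBourdonRamey2001, Ch. 1] -/
theorem fderiv_re_one_sub_I_mul_fderiv_re_I {H : ℂ → ℂ} {H' z : ℂ} (hH : HasDerivAt H H' z) :
    ((fderiv ℝ (fun w => (H w).re) z 1 : ℂ) - I * fderiv ℝ (fun w => (H w).re) z I) = H' := by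
  rw [fderiv_re_comp_apply hH, fderiv_re_comp_apply hH]
  apply Complex.ext <;> simp

end RealPart

/-! ## §4 The theorem: a homogeneous harmonic function of degree `k ≥ 1` on a sector is `Re (c·zᵏ)` -/

section Main

variable {S : Set ℂ} {f : ℂ → ℝ} {k : ℕ}

/-- A real-linear functional on `ℂ` vanishing at `1` and `I` vanishes. [folklore] -/
private theorem clm_eq_zero_of_apply_one_I {L : ℂ →L[ℝ] ℝ} (h1 : L 1 = 0) (hI : L I = 0) : L = 0 := by
  ext v
  have hv : v = (v.re : ℝ) • (1 : ℂ) + (v.im : ℝ) • I := by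
    rw [Complex.real_smul, Complex.real_smul, mul_one]; exact (Complex.re_add_im v).symm
  rw [hv, map_add, map_smul, map_smul, h1, hI]
  simp

/-- **HOMOGENEOUS HARMONIC FUNCTIONS ON A PLANE SECTOR ARE HARMONIC POLYNOMIALS.**  Let `S ⊆ ℂ` be open, preconnected, `0 ∉ S`, stable under
`z ↦ r·z` (`r > 0`); let `f : ℂ → ℝ` be harmonic on `S` (Mathlib `InnerProductSpace.HarmonicOnNhd`) and positively homogeneous of degree `k ≥ 1`
on `S`.  Then `f z = Re (c·zᵏ)` on `S` for one `c ∈ ℂ` — in polar coordinates `rᵏ(A cos kφ + B sin kφ)`, the general solution of `g″ + k²g = 0`.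
(False for `k = 0`: `arg`.) [cite: AxlerBourdonRamey2001, Ch. 1; Ch. 5] -/
theorem exists_eq_re_const_mul_pow_of_harmonicOnNhd_of_homogeneous (hS : IsOpen S) (hSc : IsPreconnected S) (h0 : (0 : ℂ) ∉ S)
    (hdil : ∀ z ∈ S, ∀ r : ℝ, 0 < r → (r : ℂ) * z ∈ S) (hf : HarmonicOnNhd f S) (hk : 1 ≤ k)
    (hhom : ∀ z ∈ S, ∀ r : ℝ, 0 < r → f ((r : ℂ) * z) = r ^ k * f z) :
    ∃ c : ℂ, ∀ z ∈ S, f z = (c * z ^ k).re := by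
  -- `g = fₓ − i f_y` is holomorphic on `S` and homogeneous of degree `k − 1`
  set g : ℂ → ℂ := fun z => (fderiv ℝ f z 1 : ℂ) - I * fderiv ℝ f z I with hg_def
  have hgd : DifferentiableOn ℂ g S := fun z hz => (HarmonicAt.differentiableAt_complex_partial (hf z hz)).differentiableWithinAt
  have hfd : DifferentiableOn ℝ f S := fun z hz => ((hf z hz).1.differentiableAt (by norm_num)).differentiableWithinAt
  have hghom : ∀ z ∈ S, ∀ r : ℝ, 0 < r → g ((r : ℂ) * z) = (r : ℂ) ^ (k - 1) * g z := by
    intro z hz r hr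
    simp only [hg_def, fderiv_apply_mul_of_homogeneous hS hdil hfd hk hhom hz hr]
    push_cast
    ring
  obtain ⟨c, hc⟩ := exists_eq_const_mul_pow_of_homogeneous hS hSc h0 hgd hghom
  -- the harmonic polynomial `U = Re((c∕k)·zᵏ)` has the same `g`
  have hk0 : (k : ℂ) ≠ 0 := by exact_mod_cast (show k ≠ 0 by omega)
  set H : ℂ → ℂ := fun z => (c / k) * z ^ k with hH_def
  have hH : ∀ z : ℂ, HasDerivAt H (c * z ^ (k - 1)) z := by
    intro z
    have h := (hasDerivAt_pow k z).const_mul (c / k)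
    refine h.congr_deriv ?_
    rw [← mul_assoc, div_mul_cancel₀ c hk0]
  set U : ℂ → ℝ := fun z => (H z).re with hU_def
  have hUd : Differentiable ℝ U := fun z => (reCLM.differentiableAt.comp z ((hH z).differentiableAt.restrictScalars ℝ))
  -- `f − U` has zero gradient on `S`
  have hzero : ∀ z ∈ S, fderiv ℝ (fun w => f w - U w) z = 0 := by
    intro z hz
    have hfz : DifferentiableAt ℝ f z := hfd.differentiableAt (hS.mem_nhds hz)
    rw [fderiv_fun_sub hfz (hUd z)]
    have hgU : ((fderiv ℝ U z 1 : ℂ) - I * fderiv ℝ U z I) = c * z ^ (k - 1) := fderiv_re_one_sub_I_mul_fderiv_re_I (hH z)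
    have hgf : ((fderiv ℝ f z 1 : ℂ) - I * fderiv ℝ f z I) = c * z ^ (k - 1) := hc z hz
    have hdiff := hgf.trans hgU.symm
    have hre := congrArg Complex.re hdiff
    have him := congrArg Complex.im hdiff
    simp only [sub_re, ofReal_re, mul_re, I_re, zero_mul, I_im, ofReal_im, mul_zero, sub_self, sub_zero,
      sub_im, mul_im, one_mul, zero_add, zero_sub, neg_inj] at hre him
    refine clm_eq_zero_of_apply_one_I ?_ ?_
    · rw [sub_apply, hre, sub_self]
    · rw [sub_apply, him, sub_self]
  obtain ⟨a, ha⟩ := hS.exists_is_const_of_fderiv_eq_zero hSc (hfd.sub hUd.differentiableOn) (fun z hz => hzero z hz)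
  -- homogeneity kills the constant
  refine ⟨c / k, fun z hz => ?_⟩
  have hfz : f z = U z + a := by have h : f z - U z = a := ha z hz; linarith
  have h2z : ((2 : ℝ) : ℂ) * z ∈ S := hdil z hz 2 two_pos
  have hf2 : f (((2 : ℝ) : ℂ) * z) = U (((2 : ℝ) : ℂ) * z) + a := by have h : f (((2 : ℝ) : ℂ) * z) - U (((2 : ℝ) : ℂ) * z) = a := ha _ h2z; linarith
  have hU2 : U (((2 : ℝ) : ℂ) * z) = (2 : ℝ) ^ k * U z := by
    simp only [hU_def, hH_def]
    rw [mul_pow, ← Complex.ofReal_pow, show c / ↑k * (↑((2 : ℝ) ^ k) * z ^ k) = ((2 ^ k : ℝ) : ℂ) * (c / ↑k * z ^ k) by ring,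
      re_ofReal_mul]
  have hhom2 := hhom z hz 2 two_pos
  rw [hf2, hU2, hfz] at hhom2
  -- `2ᵏ U + a = 2ᵏ (U + a)` forces `a = 0` since `2ᵏ ≠ 1`
  have hk2 : (2 : ℝ) ^ k ≠ 1 := by
    have h2 : (2 : ℝ) ^ 1 ≤ 2 ^ k := pow_le_pow_right₀ (by norm_num) hk
    intro h; rw [h] at h2; norm_num at h2
  have ha0 : a = 0 := by
    have h : ((2 : ℝ) ^ k - 1) * a = 0 := by linarith
    rcases mul_eq_zero.mp h with h | h
    · exact absurd (sub_eq_zero.mp h) hk2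
    · exact h
  rw [hfz, ha0, add_zero]

/-- **Complex-valued version**: a harmonic `F : ℂ → ℂ` (i.e. `Re F`, `Im F` harmonic), positively homogeneous of degree `k ≥ 1` on an open preconnected
dilation-stable `S ∌ 0`, is `a·zᵏ + b·z̄ᵏ` on `S`. [cite: AxlerBourdonRamey2001, Ch. 1; Ch. 5] -/
theorem exists_eq_mul_pow_add_mul_conj_pow_of_harmonicOnNhd_of_homogeneous {F : ℂ → ℂ} (hS : IsOpen S) (hSc : IsPreconnected S) (h0 : (0 : ℂ) ∉ S)
    (hdil : ∀ z ∈ S, ∀ r : ℝ, 0 < r → (r : ℂ) * z ∈ S) (hF : HarmonicOnNhd F S) (hk : 1 ≤ k)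
    (hhom : ∀ z ∈ S, ∀ r : ℝ, 0 < r → F ((r : ℂ) * z) = (r : ℂ) ^ k * F z) :
    ∃ a b : ℂ, ∀ z ∈ S, F z = a * z ^ k + b * (starRingEnd ℂ z) ^ k := by
  have hre : HarmonicOnNhd (fun z => (F z).re) S := fun z hz => by
    simpa [Function.comp_def] using (hF z hz).comp_CLM reCLM
  have him : HarmonicOnNhd (fun z => (F z).im) S := fun z hz => by
    simpa [Function.comp_def] using (hF z hz).comp_CLM imCLM
  have hhre : ∀ z ∈ S, ∀ r : ℝ, 0 < r → (F ((r : ℂ) * z)).re = r ^ k * (F z).re := fun z hz r hr => by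
    rw [hhom z hz r hr, ← Complex.ofReal_pow, re_ofReal_mul]
  have hhim : ∀ z ∈ S, ∀ r : ℝ, 0 < r → (F ((r : ℂ) * z)).im = r ^ k * (F z).im := fun z hz r hr => by
    rw [hhom z hz r hr, ← Complex.ofReal_pow, im_ofReal_mul]
  obtain ⟨c₁, hc₁⟩ := exists_eq_re_const_mul_pow_of_harmonicOnNhd_of_homogeneous hS hSc h0 hdil hre hk hhre
  obtain ⟨c₂, hc₂⟩ := exists_eq_re_const_mul_pow_of_harmonicOnNhd_of_homogeneous hS hSc h0 hdil him hk hhim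
  -- `Re w = (w + w̄)∕2`, `conj (c zᵏ) = c̄ z̄ᵏ`
  refine ⟨(c₁ + I * c₂) / 2, (starRingEnd ℂ c₁ + I * starRingEnd ℂ c₂) / 2, fun z hz => ?_⟩
  have hFz : F z = ((F z).re : ℂ) + ((F z).im : ℂ) * I := (Complex.re_add_im (F z)).symm
  rw [hFz, hc₁ z hz, hc₂ z hz, Complex.re_eq_add_conj, Complex.re_eq_add_conj]
  simp only [map_mul, map_pow]
  ring

end Main

end Literature.Analysis.Potential

end
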